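import Summits.SmoothPoincare4.SmoothPoincare4.Theorems.ConvexBisectionAcyclicBisectionExistsBeltCoreTwisting
import Literature.Geometry.Symplectic.TwoHandleIsotopyProofs
import HarnessLib

/-!
# N3 (`stub_STgeo`) ▸ N3-nat ▸ N3d-1 ▸ N3c: THE BLOCK ATTACHING MAP OF A TUBE — the once-twisted
# standard tube map of a circle tube in `∂ Base g`, its attaching circle, handle framing and
# boundary-torus values
(wave 7, brick H6-3 of stub `stub_STgeo` = node N3 of NF4, line `modp-braid-orbits`, crux
`ConvexBisection.AcyclicBisectionExists`, item stmt-SmoothPoincare4-10508; registered sub-goal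
`helper_exists_blockMap_of_tube`; design file `work/design/N3_Stabilisation_Design.lean` (G5, wave 6),
clause `qA_tube`/`qA_circle` of `StabBaseData` (`…StabilisationData.lean`, H6-1).)

The block 2-handles `qA`, `qB` of the stabilised base data are required (clause `qA_tube`) to be THE
STANDARD TUBE MAP (`TubeAttachData.attachingMap`, `HandleAttachingMapOfTube.lean`: Kosinski's
`h̄ y = c (Φ (x_λ/|x_λ|, κ x_μ), δ (1 − ‖x‖²))`) of a fibred tube `Φ` around the block curve, with
Kosinski's fibre coordinate twisted ONCE around the core (so that the handle framing has page twisting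
`−1`).  This file builds that map from ANY circle tube `Φ₀ : CircleTube (∂ Base g)` (Kosinski 1993,
III (3.1)): the tube datum is Z4's `twistTube Φ₀ (−1)` (`…PageTube.lean`: `(ψ, v) ↦ Φ₀ (ψ, ψ̄ · v)`)
prolonged along a collar of the compact base (`BoundaryData.nonempty_collar_of_compactSpace`), rescaled
into a prescribed neighbourhood of the core (`TubeAttachData.exists_rescale_range_subset`), and we read
off (`exists_blockMap_of_tube`, registered `helper_exists_blockMap_of_tube`):

* the range lies in the prescribed open `U ⊇ core`;
* the attaching circle is the core `θ ↦ Φ₀ (θ, 0)` (`attachingCircle_attachingMap`);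
* **the handle framing is the velocity `d/ds|₀ Φ₀ (θ, κ sin s · (θ₀, −θ₁))`** of the once-twisted fibre
  direction (`attachingFraming_eq_mfderiv_comp_tubeArcPt` + `attachingMap_tubeArcPt`; `ψ̄ · e₀ =
  reflFibre (−1) ψ`), the input of the page-twisting computation of `…StabBlockMapTwist.lean` (H6-4);
* **the boundary-torus values**: at `y = (√(1−‖v‖²) x, v) ∈ T ∩ ∂D⁴`, `‖v‖ < 1`, the map is
  `Φ₀ (x, κ (x₀v₀ + x₁v₁, x₀v₁ − x₁v₀))` — VERBATIM the shape of clause `qA_tube` of `StabBaseData`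
  with `s = true`.

Everything is proved; no definitions, no named facts.  References: A. A. Kosinski, *Differential
Manifolds* (1993), III (3.1), III §4, VI §6 [Kosinski1993]; R. C. Kirby, *The Topology of
4-Manifolds*, LNM 1374 (1989), Ch. I §2 (the handle framing `f(S¹ × e₁)`) [Kirby1989].
-/

noncomputable section

-- the prescribed namespace `Summit.<P>.<Sub>.…` duplicates `SmoothPoincare4` (P = Sub)
set_option linter.dupNamespace false

open scoped Manifold ContDiff Topology Real
open Set Function Metric

namespace Summit.SmoothPoincare4.SmoothPoincare4.Theorems.AcyclicBisectionExists.ModpBraidOrbits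

open Literature.Topology.FourManifolds Literature.Topology.FourManifolds.LefschetzBase
open Literature.Topology.FourManifolds.HandleAttachingMap
open Literature.Geometry.Symplectic

namespace StabBlockMap

variable {g : ℕ}

/-! ## §1 Coordinates: the once-twisted fibre and the boundary-torus points of `T` -/

/-- The once-twisted fibre direction `ψ̄ · e₀ = (ψ₀, −ψ₁)` is the reflected fibre `reflFibre (−1) ψ`.
[folklore] -/
theorem fibreRot_neg_one_single (u : EuclideanSpace ℝ (Fin 2)) :
    fibreRot (-1) u (EuclideanSpace.single (0 : Fin 2) (1 : ℝ)) = reflFibre (-1) u := by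
  ext i
  fin_cases i <;> simp [reflFibre, planeE0, planeE1]

/-- The once-twisted fibre in coordinates: `ψ̄ · v = (ψ₀ v₀ + ψ₁ v₁, ψ₀ v₁ − ψ₁ v₀)`. [folklore] -/
theorem fibreRot_neg_one_eq (u v : EuclideanSpace ℝ (Fin 2)) :
    fibreRot (-1) u v = WithLp.toLp 2 ![u 0 * v 0 + u 1 * v 1, u 0 * v 1 - u 1 * v 0] := by
  ext i
  fin_cases i
  · simp
  · simp; ring

/-- The boundary-torus point `(√(1−‖v‖²) x, v)` of `∂D⁴` is `mkVec x v 0`. [folklore] -/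
theorem mkVec_zero_eq (x : sphere (0 : EuclideanSpace ℝ (Fin 2)) 1) (v : EuclideanSpace ℝ (Fin 2)) :
    mkVec (x : EuclideanSpace ℝ (Fin 2)) v 0 =
      WithLp.toLp 2 ![Real.sqrt (1 - ‖v‖ ^ 2) * (x : EuclideanSpace ℝ (Fin 2)) 0,
        Real.sqrt (1 - ‖v‖ ^ 2) * (x : EuclideanSpace ℝ (Fin 2)) 1, v 0, v 1] := by
  rw [mkVec, sub_zero]
  ext i
  fin_cases i <;> simp [lamEmbed, muEmbed]

/-- **A point of `T` with boundary-torus coordinates `(√(1−‖v‖²) x, v)`, `‖v‖ < 1`, IS the tube point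
`mkTubePt x v 0`** (depth `0`). [folklore] -/
theorem eq_mkTubePt_of_coe_eq (x : sphere (0 : EuclideanSpace ℝ (Fin 2)) 1) (v : EuclideanSpace ℝ (Fin 2))
    (hv : ‖v‖ < 1) (y : ↥(handleTube 3 2))
    (hy : ((y : closedBall (0 : EuclideanSpace ℝ (Fin 4)) 1) : EuclideanSpace ℝ (Fin 4)) =
      WithLp.toLp 2 ![Real.sqrt (1 - ‖v‖ ^ 2) * (x : EuclideanSpace ℝ (Fin 2)) 0,
        Real.sqrt (1 - ‖v‖ ^ 2) * (x : EuclideanSpace ℝ (Fin 2)) 1, v 0, v 1]) :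
    y = mkTubePt x v 0 le_rfl (by have := abs_lt.1 (abs_norm v ▸ hv); nlinarith [norm_nonneg v]) := by
  apply Subtype.ext; apply Subtype.ext
  rw [hy]
  exact (mkVec_zero_eq x v).symm

/-- Such a point lies on the sphere `∂D⁴`. [folklore] -/
theorem norm_tubeVec_mkTubePt_zero (x : sphere (0 : EuclideanSpace ℝ (Fin 2)) 1) (v : EuclideanSpace ℝ (Fin 2))
    (h : 0 < 1 - 0 - ‖v‖ ^ 2) : ‖tubeVec (mkTubePt x v 0 le_rfl h)‖ = 1 := by
  have h1 : ‖tubeVec (mkTubePt x v 0 le_rfl h)‖ ^ 2 = 1 := by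
    rw [tubeVec_mkTubePt, norm_mkVec_sq x v h.le]; ring
  nlinarith [norm_nonneg (tubeVec (mkTubePt x v 0 le_rfl h))]

/-! ## §2 The tube datum of the once-twisted tube and its attaching map -/

/-- The tube datum: Z4's once-twisted tube `twistTube Φ₀ (−1)` of radius `1`, a collar of the compact
base, radius `κ ≤ 1/4`, height `δ ≤ 1/2`. [cite: Kosinski1993, III §4] -/
theorem exists_tubeAttachData (Φ₀ : CircleTube (bBase g).carrier) {κ δ : ℝ} (hκ : 0 < κ) (hκ1 : κ ≤ 1)
    (hδ : 0 < δ) (hδ1 : δ ≤ 1 / 2) :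
    ∃ A : TubeAttachData (Base g), A.tube = (twistTube Φ₀ (-1) (by norm_num)).toHomeo ∧ A.κ = κ ∧ A.δ = δ := by
  obtain ⟨col⟩ := BoundaryData.nonempty_collar_of_compactSpace 2 (Base g) (bBase g)
  exact ⟨{ tube := (twistTube Φ₀ (-1) (by norm_num)).toHomeo, ε := 1,
           source_eq := (twistTube Φ₀ (-1) (by norm_num)).source_eq,
           smooth := (twistTube Φ₀ (-1) (by norm_num)).contMDiffOn_toHomeo,
           smooth_symm := (twistTube Φ₀ (-1) (by norm_num)).contMDiffOn_symm,
           col := col, κ := κ, δ := δ, κ_pos := hκ, κ_le := hκ1, δ_pos := hδ, δ_le := hδ1 }, rfl, rfl, rfl⟩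

/-- **The attaching map of a tube datum whose tube is the once-twisted `Φ₀`**: attaching circle = the
core of `Φ₀`; handle framing = `d/ds|₀ Φ₀ (θ, κ sin s · reflFibre (−1) θ)`; boundary-torus values
`Φ₀ (x, κ (x₀v₀ + x₁v₁, x₀v₁ − x₁v₀))`. [cite: Kosinski1993, VI §6] -/
theorem attachingMap_of_tube_eq (Φ₀ : CircleTube (bBase g).carrier) (A : TubeAttachData (Base g))
    (hA : A.tube = (twistTube Φ₀ (-1) (by norm_num)).toHomeo) :
    (∀ θ, A.attachingMap.attachingCircle θ = (bBase g).incl (Φ₀.core θ)) ∧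
    (∀ θ : sphere (0 : EuclideanSpace ℝ (Fin 2)) 1, A.attachingMap.attachingFraming θ =
      mfderiv 𝓘(ℝ, ℝ) (𝓡∂ 4) (fun s : ℝ => (bBase g).incl (Φ₀.toHomeo
        (θ, (A.κ * Real.sin s) • reflFibre (-1) (θ : EuclideanSpace ℝ (Fin 2))))) 0 (1 : ℝ)) ∧
    (∀ (x : sphere (0 : EuclideanSpace ℝ (Fin 2)) 1) (v : EuclideanSpace ℝ (Fin 2)) (_ : ‖v‖ < 1)
      (y : ↥(handleTube 3 2)),
      ((y : closedBall (0 : EuclideanSpace ℝ (Fin 4)) 1) : EuclideanSpace ℝ (Fin 4)) =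
        WithLp.toLp 2 ![Real.sqrt (1 - ‖v‖ ^ 2) * (x : EuclideanSpace ℝ (Fin 2)) 0,
          Real.sqrt (1 - ‖v‖ ^ 2) * (x : EuclideanSpace ℝ (Fin 2)) 1, v 0, v 1] →
      A.attachingMap.toFun y = (bBase g).incl (Φ₀.toHomeo (x, A.κ • WithLp.toLp 2
        ![(x : EuclideanSpace ℝ (Fin 2)) 0 * v 0 + (x : EuclideanSpace ℝ (Fin 2)) 1 * v 1,
          (x : EuclideanSpace ℝ (Fin 2)) 0 * v 1 - (x : EuclideanSpace ℝ (Fin 2)) 1 * v 0]))) := by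
  refine ⟨fun θ => ?_, fun θ => ?_, fun x v hv y hy => ?_⟩
  · rw [A.attachingCircle_attachingMap θ, hA]
    change (bBase g).incl ((twistTube Φ₀ (-1) _).toHomeo (θ, 0)) = _
    rw [twistTube_apply, fibreRot_zero, CircleTube.core_apply]
  · have hfun : (fun s : ℝ => (bBase g).incl ((twistTube Φ₀ (-1) (by norm_num)).toHomeo
        (θ, A.κ • (Real.sin s • EuclideanSpace.single (0 : Fin 2) (1 : ℝ))))) =
        fun s : ℝ => (bBase g).incl (Φ₀.toHomeo
          (θ, (A.κ * Real.sin s) • reflFibre (-1) (θ : EuclideanSpace ℝ (Fin 2)))) := by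
      funext s
      rw [twistTube_apply, fibreRot_smul, fibreRot_smul, fibreRot_neg_one_single, smul_smul]
    rw [attachingFraming_eq_mfderiv_comp_tubeArcPt A.attachingMap θ,
      (A.attachingMap_tubeArcPt_eventuallyEq θ).mfderiv_eq, hA]
    exact congrArg (fun f : ℝ → Base g => mfderiv 𝓘(ℝ, ℝ) (𝓡∂ 4) f 0 (1 : ℝ)) hfun
  · have h0 : 0 < 1 - 0 - ‖v‖ ^ 2 := by
      have := abs_lt.1 (abs_norm v ▸ hv); nlinarith [norm_nonneg v]
    have hy' := eq_mkTubePt_of_coe_eq x v hv y hy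
    subst hy'
    show A.map _ = _
    rw [A.map_of_norm_eq_one (norm_tubeVec_mkTubePt_zero x v h0), TubeAttachData.liftFst,
      tubeAngle_mkTubePt, tubeFibre_mkTubePt, hA]
    change (bBase g).incl ((twistTube Φ₀ (-1) _).toHomeo (x, A.κ • v)) = _
    rw [twistTube_apply, fibreRot_smul, fibreRot_neg_one_eq]

/-- **The block attaching map of a circle tube** (`exists_blockMap_of_tube`): for every circle tube
`Φ₀` in `∂ Base g` and every open `U` containing its core there are an attaching map `q` of a 2-handle
on `Base g` and a radius `0 < κ ≤ 1/4` with: range in `U`; attaching circle the core of `Φ₀`; handle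
framing the velocity `d/ds|₀ Φ₀ (θ, κ sin s · reflFibre (−1) θ)` of the once-twisted fibre direction;
and boundary-torus values `q (√(1−‖v‖²) x, v) = Φ₀ (x, κ (x₀v₀ + x₁v₁, x₀v₁ − x₁v₀))`, `‖v‖ < 1`
(the shape of clause `qA_tube` of `StabBaseData`, sign `s = true`). [cite: Kosinski1993, VI §6] -/
theorem exists_blockMap_of_tube (Φ₀ : CircleTube (bBase g).carrier) {U : Set (Base g)} (hU : IsOpen U)
    (hKU : ∀ θ, (bBase g).incl (Φ₀.core θ) ∈ U) :
    ∃ (q : HandleAttachingMap 3 2 (Base g)) (κ : ℝ), 0 < κ ∧ κ ≤ 1 / 4 ∧ range q.toFun ⊆ U ∧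
      (∀ θ, q.attachingCircle θ = (bBase g).incl (Φ₀.core θ)) ∧
      (∀ θ : sphere (0 : EuclideanSpace ℝ (Fin 2)) 1, q.attachingFraming θ =
        mfderiv 𝓘(ℝ, ℝ) (𝓡∂ 4) (fun s : ℝ => (bBase g).incl (Φ₀.toHomeo
          (θ, (κ * Real.sin s) • reflFibre (-1) (θ : EuclideanSpace ℝ (Fin 2))))) 0 (1 : ℝ)) ∧
      (∀ (x : sphere (0 : EuclideanSpace ℝ (Fin 2)) 1) (v : EuclideanSpace ℝ (Fin 2)) (_ : ‖v‖ < 1)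
        (y : ↥(handleTube 3 2)),
        ((y : closedBall (0 : EuclideanSpace ℝ (Fin 4)) 1) : EuclideanSpace ℝ (Fin 4)) =
          WithLp.toLp 2 ![Real.sqrt (1 - ‖v‖ ^ 2) * (x : EuclideanSpace ℝ (Fin 2)) 0,
            Real.sqrt (1 - ‖v‖ ^ 2) * (x : EuclideanSpace ℝ (Fin 2)) 1, v 0, v 1] →
        q.toFun y = (bBase g).incl (Φ₀.toHomeo (x, κ • WithLp.toLp 2
          ![(x : EuclideanSpace ℝ (Fin 2)) 0 * v 0 + (x : EuclideanSpace ℝ (Fin 2)) 1 * v 1,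
            (x : EuclideanSpace ℝ (Fin 2)) 0 * v 1 - (x : EuclideanSpace ℝ (Fin 2)) 1 * v 0]))) := by
  obtain ⟨A, hA, hAκ, -⟩ := exists_tubeAttachData Φ₀ (κ := 1 / 4) (δ := 1 / 2) (by norm_num)
    (by norm_num) (by norm_num) le_rfl
  have hKU' : ∀ θ : sphere (0 : EuclideanSpace ℝ (Fin 2)) 1,
      (BoundaryManifold.boundaryData 3 (Base g)).incl (A.tube (θ, 0)) ∈ U := by
    intro θ
    rw [hA]
    change (bBase g).incl ((twistTube Φ₀ (-1) _).toHomeo (θ, 0)) ∈ U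
    rw [twistTube_apply, fibreRot_zero]
    exact hKU θ
  obtain ⟨κ', δ', hκ', hκ'le, hδ', hδ'le, hrange⟩ := A.exists_rescale_range_subset hU hKU'
  obtain ⟨hc, hf, ht⟩ := attachingMap_of_tube_eq Φ₀ (A.rescale κ' δ' hκ' hκ'le hδ' hδ'le)
    (by rw [TubeAttachData.rescale_tube, hA])
  exact ⟨(A.rescale κ' δ' hκ' hκ'le hδ' hδ'le).attachingMap, κ', hκ', hκ'le.trans hAκ.le, hrange,
    hc, hf, ht⟩

end StabBlockMap

/-! ## Registered helper -/

/-- **Registered helper `helper_exists_blockMap_of_tube` (sub-goal of `stub_STgeo` ▸ N3-nat ▸ N3d-1 ▸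
N3c, wave 7, lead c5): the block attaching map of a circle tube in `∂ Base g` — the once-twisted
standard tube map prolonged along a collar, inside any prescribed neighbourhood of the core, with its
attaching circle, handle framing and boundary-torus values read off.** [cite: Kosinski1993, VI §6] -/
theorem helper_exists_blockMap_of_tube : ∀ (g : ℕ) (Φ₀ : Literature.Topology.FourManifolds.CircleTube (Literature.Topology.FourManifolds.LefschetzBase.bBase g).carrier) (U : Set (Literature.Topology.FourManifolds.LefschetzBase.Base g)), IsOpen U → (∀ θ, (Literature.Topology.FourManifolds.LefschetzBase.bBase g).incl (Φ₀.core θ) ∈ U) → ∃ (q : Literature.Topology.FourManifolds.HandleAttachingMap 3 2 (Literature.Topology.FourManifolds.LefschetzBase.Base g)) (κ : ℝ), 0 < κ ∧ κ ≤ 1 / 4 ∧ Set.range q.toFun ⊆ U ∧ (∀ θ, q.attachingCircle θ = (Literature.Topology.FourManifolds.LefschetzBase.bBase g).incl (Φ₀.core θ)) ∧ (∀ θ : Metric.sphere (0 : EuclideanSpace ℝ (Fin 2)) 1, q.attachingFraming θ = mfderiv 𝓘(ℝ, ℝ) (𝓡∂ 4) (fun s : ℝ => (Literature.Topology.FourManifolds.LefschetzBase.bBase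 g).incl (Φ₀.toHomeo (θ, (κ * Real.sin s) • Summit.SmoothPoincare4.SmoothPoincare4.Theorems.AcyclicBisectionExists.ModpBraidOrbits.reflFibre (-1) (θ : EuclideanSpace ℝ (Fin 2))))) 0 (1 : ℝ)) ∧ (∀ (x : Metric.sphere (0 : EuclideanSpace ℝ (Fin 2)) 1) (v : EuclideanSpace ℝ (Fin 2)) (_ : ‖v‖ < 1) (y : ↥(Literature.Topology.FourManifolds.handleTube 3 2)), ((y : Metric.closedBall (0 : EuclideanSpace ℝ (Fin 4)) 1) : EuclideanSpace ℝ (Fin 4)) = WithLp.toLp 2 ![Real.sqrt (1 - ‖v‖ ^ 2) * (x : EuclideanSpace ℝ (Fin 2)) 0, Real.sqrt (1 - ‖v‖ ^ 2) * (x : EuclideanSpace ℝ (Fin 2)) 1, v 0, v 1] → q.toFun y = (Literature.Topology.FourManifolds.LefschetzBase.bBase g).incl (Φ₀.toHomeo (x, κ • WithLp.toLp 2 ![(x : EuclideanSpace ℝ (Fin 2)) 0 * v 0 + (x : EuclideanSpace ℝ (Fin 2)) 1 * v 1, (x : EuclideanSpace ℝ (Fin 2)) 0 * v 1 - (x : EuclideanSpace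 ℝ (Fin 2)) 1 * v 0]))) :=
  fun _ Φ₀ _ hU hKU => StabBlockMap.exists_blockMap_of_tube Φ₀ hU hKU

end Summit.SmoothPoincare4.SmoothPoincare4.Theorems.AcyclicBisectionExists.ModpBraidOrbits

end
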